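import Summits.QuantumFields.GaugeBoot.DiagonalRPTorusTubeEstimate
import HarnessLib

/-!
# Inner-half diagonal RP fails on every even torus `(ℤ/L)^d`, `d ≥ 4`, `L ≥ 4`, at small
coupling: the estimate (gauge-boot, task L3 sequel, 13/14)

HONEST FRAMING (cell `pub-gaugeboot`, page 1 of every file): the venture produces certified bounds
on lattice expectations at stated coupling, gauge group, dimension and torus size; NOT a mass gap,
NOT a continuum limit, NOT a string tension; NOT Yang–Mills-summit-bearing (barriers
`FixedCouplingUltralocality`, `PerturbativeInvisibility`). This module is a structural NEGATIVE
result about which positivity constraints a TORUS certificate may use; it discharges nothing else.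

## Content (torus `(ℤ/L)^d`, `L = 2c`, `c ≥ 2`, `i < j < k < l` so `d ≥ 4`; compact metrisable
`G`, continuous `ρ` with a centre element `ρ z₀ = ω • 1`, `ω ≠ 1`, and the character identity
(R1) `∫ Re χ(x g⁻¹) Re χ(g y) dg = c₁ Re χ(x y)`, `c₁ > 0`)

THE WITNESS. `p = sq k l y₀`, the transverse unit square at `y₀ = (c-1) e_i` (top inner layer
`δ = c - 1`), and `p̃ = sq k l x₁`, `x₁ = θy₀ - 2e_i` (same layer), where `θ` swaps the
coordinates `i, j`; the observable is `F = (Re tr ρ(U_p) - Re tr ρ(U_{p̃})) · e^{-β halfSum}`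
(`DiagonalRPTorusHalfAction`). By the half-action trick its RP form is, up to a positive factor,
`Σ_{Q ⊆ rest} [T_Q(θp,p) - T_Q(θp,p̃) - T_Q(θp̃,p) + T_Q(θp̃,p̃)]`; by `tube_shape` the terms
with `|Q| ≤ 8` vanish except the two straight TUBES (`θp = sq (x₁ + 2e_i)`,
`θp̃ = sq (y₀ - 2e_j)`), each `= β⁸ c₁⁹ N + O(β⁹)` (`pairT_tubeSet_ge`), and the terms with
`|Q| ≥ 9` are `O(β⁹)`:

* **`trickForm_witness_le`** — `trickForm ≤ -2 β⁸ c₁⁹ N + β⁹ C(L, N, d)` for `0 ≤ β`, `2βN ≤ 1`.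

The refutations themselves (`¬ InnerDiagonalRP` for `0 < β ≤ β₀(L, N, d)`, and the `SU(N)` /
`U(N)` specialisations) are in `DiagonalRPTorusInnerHalfNegativeHighDimMain`. Elementary
strong-coupling expansion; not in print as far as the cell's searches go (printed precedent for
the phenomenon in spin systems: FILS, J. Stat. Phys. 22 (1980) 297, §3; Biskup, LNM 1970 (2009)
§5.5).
-/

open MeasureTheory Finset Function
open scoped ComplexOrder

namespace Summit.QuantumFields.GaugeBoot

open Literature.MathematicalPhysics.QuantumFieldTheory
open Literature.MathematicalPhysics.QuantumFieldTheory.PlaquetteLowerBound (reTr)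
open Summit.Ventures.YMGap.RobustBall (one_ne_zero_of_three_le two_ne_zero_of_three_le)

noncomputable section

namespace DiagRPTube

variable {d L : ℕ} [NeZero L] {N : ℕ} {G : Type*} [Group G] [TopologicalSpace G]
  [IsTopologicalGroup G] [CompactSpace G] [MeasurableSpace G] [BorelSpace G]
  [SecondCountableTopology G] (ρ : G →* Matrix (Fin N) (Fin N) ℂ)
  {i j k l : Fin d} (hij : i < j) (hjk : j < k) (hkl : k < l) {c : ℕ} (hc : 2 ≤ c) (hL : L = 2 * c)

/-- The WITNESS BASE `y₀ = (c-1) e_i`. -/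
def baseLow (i : Fin d) (c : ℕ) : Site d L := Pi.single i ((c - 1 : ℕ) : ZMod L)

/-- The second witness base `x₁ = θ y₀ - 2 e_i = (c-1) e_j - 2 e_i`. -/
def baseLow' (i j : Fin d) (c : ℕ) : Site d L := dn (dn (Pi.single j ((c - 1 : ℕ) : ZMod L)) i) i

section Geometry

omit [NeZero L]

include hij in
/-- `δ(y₀) = c - 1`. -/
theorem lay_baseLow : lay i j (baseLow (L := L) i c) = ((c - 1 : ℕ) : ZMod L) := by
  have hij' : i ≠ j := ne_of_lt hij
  simp [lay, baseLow, Pi.single_eq_of_ne hij'.symm]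

include hc hL in
/-- `2(c-1) + 2 = 0` in `ℤ/(2c)`. -/
theorem two_pred_add_two : ((c - 1 : ℕ) : ZMod L) + 1 + 1 + ((c - 1 : ℕ) : ZMod L) = 0 := by
  have h2 : ((2 * c : ℕ) : ZMod L) = 0 := by rw [← hL]; exact ZMod.natCast_self L
  have h3 : ((c - 1 : ℕ) : ZMod L) + 1 = (c : ℕ) := cast_pred_add_one (L := L) hc
  push_cast at h2
  linear_combination h2 + 2 * h3

include hij hc hL in
/-- `δ(x₁) = c - 1`. -/
theorem lay_baseLow' : lay i j (baseLow' (L := L) i j c) = ((c - 1 : ℕ) : ZMod L) := by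
  have hij' : i ≠ j := ne_of_lt hij
  unfold baseLow'
  rw [lay_dn_i hij', lay_dn_i hij']
  simp only [lay, Pi.single_eq_of_ne hij', Pi.single_eq_same]
  linear_combination -(two_pred_add_two hc hL)

include hij in
/-- `θ y₀ = x₁ + 2e_i`. -/
theorem swap_baseLow : siteDiagSwap i j (baseLow (L := L) i c) = ((baseLow' (L := L) i j c).shift i).shift i := by
  unfold baseLow baseLow'
  rw [siteDiagSwap_single hij, dn_shift, dn_shift]

include hij in
/-- `θ x₁ = y₀ - 2e_j`. -/
theorem swap_baseLow' : siteDiagSwap i j (baseLow' (L := L) i j c) = dn (dn (baseLow (L := L) i c) j) j := by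
  unfold baseLow baseLow'
  rw [siteDiagSwap_dn_i, siteDiagSwap_dn_i]
  congr 2
  have h := congrArg (siteDiagSwap (L := L) i j) (siteDiagSwap_single (L := L) hij ((c - 1 : ℕ) : ZMod L))
  rw [siteDiagSwap_siteDiagSwap] at h
  exact h.symm

include hij in
/-- `δ(θ y₀) = -(c-1)`. -/
theorem lay_swap_baseLow : lay i j (siteDiagSwap i j (baseLow (L := L) i c)) = -((c - 1 : ℕ) : ZMod L) := by
  rw [lay_siteDiagSwap, lay_baseLow hij]

include hij hc hL in
/-- `δ(θ x₁) = -(c-1)`. -/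
theorem lay_swap_baseLow' : lay i j (siteDiagSwap i j (baseLow' (L := L) i j c)) = -((c - 1 : ℕ) : ZMod L) := by
  rw [lay_siteDiagSwap, lay_baseLow' hij hc hL]

include hc hL in
/-- The three values excluded by the offset test: `c - 1 ∉ {0, -1, -2}` in `ℤ/(2c)`. -/
theorem pred_ne_values : ((c - 1 : ℕ) : ZMod L) ≠ 0 ∧ ((c - 1 : ℕ) : ZMod L) + 1 ≠ 0 ∧
    ((c - 1 : ℕ) : ZMod L) + 1 + 1 ≠ 0 := by
  refine ⟨cast_pred_ne_zero hc hL, ?_, ?_⟩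
  · rw [cast_pred_add_one (L := L) hc]
    intro h
    have := congrArg ZMod.val h
    rw [val_cast (by omega), ZMod.val_zero] at this
    omega
  · rw [cast_pred_add_one (L := L) hc, ← Nat.cast_add_one]
    intro h
    rw [ZMod.natCast_eq_zero_iff] at h
    exact absurd (Nat.le_of_dvd (by omega) h) (by omega)

include hij hc hL in
/-- **The diagonal pair `(θp, p)` has no tube offset.** -/
theorem offsets_pp : siteDiagSwap i j (baseLow (L := L) i c) ≠ ((baseLow (L := L) i c).shift i).shift i ∧
    siteDiagSwap i j (baseLow (L := L) i c) ≠ dn ((baseLow (L := L) i c).shift i) j ∧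
    siteDiagSwap i j (baseLow (L := L) i c) ≠ (dn (baseLow (L := L) i c) j).shift i ∧
    siteDiagSwap i j (baseLow (L := L) i c) ≠ dn (dn (baseLow (L := L) i c) j) j := by
  have hij' : i ≠ j := ne_of_lt hij
  obtain ⟨h0, h1, h2⟩ := pred_ne_values hc hL
  unfold baseLow
  rw [siteDiagSwap_single hij]
  refine ⟨fun h => ?_, fun h => ?_, fun h => ?_, fun h => ?_⟩ <;>
  · have e := congrFun h j
    simp only [Site.shift, dn, Pi.add_apply, Pi.sub_apply, Pi.single_eq_same,
      Pi.single_eq_of_ne hij'.symm] at e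
    first
      | exact h0 (by linear_combination e)
      | exact h1 (by linear_combination e)
      | exact h2 (by linear_combination e)

include hij hc hL in
/-- **The diagonal pair `(θp̃, p̃)` has no tube offset.** -/
theorem offsets_pp' :
    siteDiagSwap i j (baseLow' (L := L) i j c) ≠ ((baseLow' (L := L) i j c).shift i).shift i ∧
    siteDiagSwap i j (baseLow' (L := L) i j c) ≠ dn ((baseLow' (L := L) i j c).shift i) j ∧
    siteDiagSwap i j (baseLow' (L := L) i j c) ≠ (dn (baseLow' (L := L) i j c) j).shift i ∧
    siteDiagSwap i j (baseLow' (L := L) i j c) ≠ dn (dn (baseLow' (L := L) i j c) j) j := by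
  have hij' : i ≠ j := ne_of_lt hij
  obtain ⟨h0, h1, h2⟩ := pred_ne_values hc hL
  rw [swap_baseLow' hij]
  unfold baseLow baseLow'
  refine ⟨fun h => ?_, fun h => ?_, fun h => ?_, fun h => ?_⟩ <;>
  · have e := congrFun h i
    simp only [Site.shift, dn, Pi.add_apply, Pi.sub_apply, Pi.single_eq_same,
      Pi.single_eq_of_ne hij'] at e
    first
      | exact h0 (by linear_combination e)
      | exact h1 (by linear_combination e)
      | exact h2 (by linear_combination e)

end Geometry

/-! ## The estimate -/

section Estimate

variable (hρ : Continuous ρ) {z₀ : G} {ω : ℂ} (hz₀ : ρ z₀ = ω • (1 : Matrix (Fin N) (Fin N) ℂ))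
  (hω : ω ≠ 1) {c₁ : ℝ}
  (hR1 : ∀ x y : G, ∫ g, reTr ρ (x * g⁻¹) * reTr ρ (g * y) ∂haarProbability G = c₁ * reTr ρ (x * y))

include hij hjk hkl hc hL hρ hz₀ hω hR1

/-- ★ **THE ESTIMATE.** For `0 ≤ β`, `2βN ≤ 1` the trick form of the witness satisfies
`trickForm ≤ -2 β⁸ c₁⁹ N + β⁹ · C` with
`C = 2 N² 2⁸ N⁹ + 2^{#rest} · 4 N² 2⁹ N⁹`. -/
theorem trickForm_witness_le {β : ℝ} (hβ : 0 ≤ β) (hβN : 2 * β * N ≤ 1) :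
    trickForm ρ i j c β (fun U => WilsonRP.plaqRe ρ U (sq k l hkl (baseLow (L := L) i c)) -
        WilsonRP.plaqRe ρ U (sq k l hkl (baseLow' (L := L) i j c))) ≤
      -(2 * (β ^ 8 * (c₁ ^ 9 * N))) + β ^ 9 * (2 * (N ^ 2 * (2 ^ 8 * N ^ 9)) +
        2 ^ (restPlaqs (L := L) i j c).card * (4 * (N ^ 2 * (2 ^ 9 * N ^ 9)))) := by
  have hL3 : 3 ≤ L := by omega
  have hik : i < k := hij.trans hjk
  have hil : i < l := hij.trans (hjk.trans hkl)
  have hjl : j < l := hjk.trans hkl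
  have hβN1 : β * N ≤ 1 := by nlinarith [mul_nonneg hβ (Nat.cast_nonneg N : (0 : ℝ) ≤ N)]
  set y₀ : Site d L := baseLow (L := L) i c with hy₀
  set x₁ : Site d L := baseLow' (L := L) i j c with hx₁
  set w₀ : Site d L := siteDiagSwap i j y₀ with hw₀
  set w₁ : Site d L := siteDiagSwap i j x₁ with hw₁
  have hly₀ : lay i j y₀ = ((c - 1 : ℕ) : ZMod L) := lay_baseLow hij
  have hlx₁ : lay i j x₁ = ((c - 1 : ℕ) : ZMod L) := lay_baseLow' hij hc hL
  have hlw₀ : lay i j w₀ = -((c - 1 : ℕ) : ZMod L) := lay_swap_baseLow hij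
  have hlw₁ : lay i j w₁ = -((c - 1 : ℕ) : ZMod L) := lay_swap_baseLow' hij hc hL
  have hw₀x : w₀ = (x₁.shift i).shift i := swap_baseLow hij
  have hw₁y : w₁ = dn (dn y₀ j) j := swap_baseLow' hij
  -- the expansion
  rw [trickForm_plaqDiff_eq_sum ρ β hρ, plaqSwap_sq hij hjk hkl, plaqSwap_sq hij hjk hkl, ← hw₀, ← hw₁]
  set R := restPlaqs (L := L) i j c with hR
  set T : Site d L → Site d L → Finset (Plaquette d L) → ℝ :=
    fun z x Q => pairT ρ β Q (sq k l hkl z) (sq k l hkl x) with hT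
  have hTdef : ∀ z x Q, pairT ρ β Q (sq k l hkl z) (sq k l hkl x) = T z x Q := fun _ _ _ => rfl
  simp_rw [hTdef]
  rw [← sum_filter_add_sum_filter_not R.powerset (fun Q => Q.card ≤ 8)]
  -- the small terms
  have hsmall : ∀ Q ∈ R.powerset.filter (fun Q => Q.card ≤ 8),
      T w₀ y₀ Q - T w₀ x₁ Q - T w₁ y₀ Q + T w₁ x₁ Q = -(T w₀ x₁ Q) - T w₁ y₀ Q := by
    intro Q hQ
    obtain ⟨hQR, hcard⟩ := mem_filter.1 hQ
    rw [mem_powerset] at hQR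
    obtain ⟨a1, a2, a3, a4⟩ := offsets_pp (L := L) hij hc hL
    obtain ⟨b1, b2, b3, b4⟩ := offsets_pp' (L := L) hij hc hL
    have h1 : T w₀ y₀ Q = 0 :=
      pairT_eq_zero_of_ne_offsets hij hjk hkl hc hL hρ hz₀ hω hly₀ hlw₀ a1 a2 a3 a4 hQR hcard
    have h4 : T w₁ x₁ Q = 0 :=
      pairT_eq_zero_of_ne_offsets hij hjk hkl hc hL hρ hz₀ hω hlx₁ hlw₁ b1 b2 b3 b4 hQR hcard
    rw [h1, h4]; ring
  rw [sum_congr rfl hsmall, sum_sub_distrib, sum_neg_distrib]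
  -- the two tubes
  have htI : tubeSet hik hil x₁ ∈ R.powerset.filter (fun Q => Q.card ≤ 8) :=
    mem_filter.2 ⟨mem_powerset.2 (tubeSet_i_subset hij hjk hkl hc hL hlx₁),
      (card_tubeSet hik hil hkl hL3 x₁).le⟩
  have htJ : tubeSet hjk hjl w₁ ∈ R.powerset.filter (fun Q => Q.card ≤ 8) := by
    refine mem_filter.2 ⟨mem_powerset.2 ?_, (card_tubeSet hjk hjl hkl hL3 w₁).le⟩
    rw [hw₁y]
    exact tubeSet_j_subset hij hjk hkl hc hL hly₀
  have hsumI : ∑ Q ∈ R.powerset.filter (fun Q => Q.card ≤ 8), T w₀ x₁ Q =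
      T w₀ x₁ (tubeSet hik hil x₁) := by
    refine sum_eq_single_of_mem _ htI fun Q hQ hne => ?_
    obtain ⟨hQR, hcard⟩ := mem_filter.1 hQ
    rw [mem_powerset] at hQR
    by_contra hT0
    exact hne (eq_tubeI_of_pairT_ne_zero hij hjk hkl hc hL hρ hz₀ hω hlx₁ hlw₀ hw₀x hQR hcard hT0)
  have hsumJ : ∑ Q ∈ R.powerset.filter (fun Q => Q.card ≤ 8), T w₁ y₀ Q =
      T w₁ y₀ (tubeSet hjk hjl w₁) := by
    refine sum_eq_single_of_mem _ htJ fun Q hQ hne => ?_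
    obtain ⟨hQR, hcard⟩ := mem_filter.1 hQ
    rw [mem_powerset] at hQR
    by_contra hT0
    refine hne ?_
    rw [eq_tubeJ_of_pairT_ne_zero hij hjk hkl hc hL hρ hz₀ hω hly₀ hlw₁ hw₁y hQR hcard hT0,
      tubeSet, union_comm, hw₁y, dn_shift]
  rw [hsumI, hsumJ]
  -- their values
  have hvI : β ^ 8 * (c₁ ^ 9 * N) - N ^ 2 * (2 ^ 8 * (β * N) ^ 9) ≤ T w₀ x₁ (tubeSet hik hil x₁) := by
    rw [← hTdef, hw₀x]
    exact pairT_tubeSet_ge ρ hik hil hkl hL3 hρ hR1 hβ hβN1 x₁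
  have hvJ : β ^ 8 * (c₁ ^ 9 * N) - N ^ 2 * (2 ^ 8 * (β * N) ^ 9) ≤ T w₁ y₀ (tubeSet hjk hjl w₁) := by
    rw [← hTdef, pairT_comm]
    have h := pairT_tubeSet_ge ρ hjk hjl hkl hL3 hρ hR1 hβ hβN1 w₁
    rwa [hw₁y, dn_shift, dn_shift, ← hw₁y] at h
  -- the large terms
  have hlarge : ∀ Q ∈ R.powerset.filter (fun Q => ¬ Q.card ≤ 8),
      T w₀ y₀ Q - T w₀ x₁ Q - T w₁ y₀ Q + T w₁ x₁ Q ≤ 4 * (N ^ 2 * (2 * β * N) ^ 9) := by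
    intro Q hQ
    obtain ⟨-, hcard⟩ := mem_filter.1 hQ
    have hb : ∀ z x, |T z x Q| ≤ N ^ 2 * (2 * β * N) ^ 9 := fun z x => by
      rw [← hTdef]
      refine (abs_pairT_le ρ β hρ hβ hβN1 Q _ _).trans ?_
      exact mul_le_mul_of_nonneg_left (pow_le_pow_of_le_one (by positivity) hβN (by omega))
        (by positivity)
    have h1 := hb w₀ y₀; have h2 := hb w₀ x₁; have h3 := hb w₁ y₀; have h4 := hb w₁ x₁
    rw [abs_le] at h1 h2 h3 h4
    linarith [h1.2, h2.1, h3.1, h4.2]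
  have hsum2 : ∑ Q ∈ R.powerset.filter (fun Q => ¬ Q.card ≤ 8),
      (T w₀ y₀ Q - T w₀ x₁ Q - T w₁ y₀ Q + T w₁ x₁ Q) ≤
      2 ^ R.card * (4 * (N ^ 2 * (2 * β * N) ^ 9)) := by
    refine (sum_le_sum hlarge).trans ?_
    rw [sum_const, nsmul_eq_mul]
    refine mul_le_mul_of_nonneg_right ?_ (by positivity)
    have : ((R.powerset.filter (fun Q => ¬ Q.card ≤ 8)).card : ℝ) ≤ (R.powerset.card : ℝ) := by
      exact_mod_cast card_filter_le _ _
    rw [card_powerset] at this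
    exact_mod_cast this
  have hpow9 : (2 * β * N) ^ 9 = β ^ 9 * (2 ^ 9 * N ^ 9) := by ring
  have hpow9' : (β * N) ^ 9 = β ^ 9 * N ^ 9 := by ring
  rw [hpow9] at hsum2
  rw [hpow9'] at hvI hvJ
  nlinarith [hsum2, hvI, hvJ]

end Estimate

end DiagRPTube

end

end Summit.QuantumFields.GaugeBoot
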